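import Mathlib
import HarnessLib
import HarnessLib.Audit
import Summits.ABC.ABC.Statement
import Literature.NumberTheory.DiophantineGeometry.AbcWave0
import Literature.NumberTheory.EllipticCurves.Szpiro
import Literature.NumberTheory.EllipticCurves.ModularCurve
import Literature.NumberTheory.EllipticCurves.ModularDegreeFormula
import Literature.NumberTheory.EllipticCurves.GlobalMinimalModel

/-!
Route: QuaternionicDegree

CLOSED (superseded) 2026-08-15T16:13:56Z by planner-rbadge-ABC-QuaternionicDegree-334a4366-g4-0 — reason: superseded:route-ABC-DefiniteXi — superseded by route-ABC-DefiniteXi — note: route-repair g4 (glue.missing + glue.extra-hypothesis; cone 24 unproved facts) → option (c): CLOSED AS SUPERSEDED by route-ABC-DefiniteXi. WHY: (1) DUPLICATE — same idea card ABC/ABC/definite-quaternion-xi-szpiro and same mechanism (Pollack–Weston Thm 6.8: η_f = ξ(N/q;q)·ord_qΔ·γ), opened 2 min apar. The file is kept as the record of this route; refuted decls are indexed as negative knowledge (`ledger negatives`).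

It suffices to show X = the MODULAR DEGREE CONJECTURE FOR SEMISTABLE CURVES in parametrisation-datum
form:
for every ε > 0 there is C such that for every semistable elliptic curve E/ℚ with globally minimal
model W, every
level N and every modular parametrisation datum D of W at level N (newform f, Néron lattice Λ_W,
Manin constant c,
degree deg), deg ≤ C · c² · N^(2+ε). The quantity deg/c² = 4π²(f,f)/covol(Λ_W) (Zagier) does not
depend on D, so X
is Frey's degree conjecture deg φ_E ≪ N_E^(2+ε) with the Manin constant made explicit.
Lean (route decl SemistableDegreeConjecture): ∀ ε > 0, ∃ C, ∀ (W : WeierstrassCurve ℚ)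
[W.IsElliptic]
[W.IsGloballyMinimal] (N) [NeZero N] (D : ModularParametrizationData W N), W.IsSemistable ℤ → (D.deg
: ℝ) ≤ C * D.c ^ 2 * N ^ (2 + ε).
X → ABC: by Zagier 4π²c²(f,f) = deg·covol(Λ_W) and the Petersson lower bound (f,f) ≫ N^(1−ε)
(Hoffstein–Lockhart),
X gives covol(Λ_W)⁻¹ = e^(2h_F) ≪ N^(1+2ε); archimedean lattice bounds give max(|Δ_min|,|c₄|³) ≪
N^(6+13ε); applied to
the (semistable, Serre-normalised) Frey curve this is generalized Szpiro on Frey curves, hence ABC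
(in-tree
abcLe_of_generalizedSzpiroBG pattern, Bombieri–Gubler Thm 12.5.12).

Rationale: WHY THIS LINE. The only unconditional machine that bounds the height of a Frey curve by its
conductor without
linear forms in logarithms is the modular parametrisation: h_F(E) = ½log deg φ − ½log(f,f) + O(1)
(Frey 1987/1997,
Murty 1999, Pasten 2024 [Frey1997Ternary, Murty1999CongruencePrimes, Pasten2024Shimura]). The degree
conjecture is the
classical equivalent of abc on this side; what is NEW here is WHERE we propose to bound it: move f_E
by
Jacquet–Langlands to the DEFINITE quaternion algebra ramified at {q,∞} (q ∣ N). Pollack–Weston's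
form of
Ribet–Takahashi [PollackWeston2011, RibetTakahashi1997] factors the congruence number η_f =
ξ_f(N/q;q)·c_q·γ with
ξ = Σ w_i φ(I_i)² the self-pairing of the primitive INTEGER JL-eigenvector on the ideal classes of
an Eichler order,
c_q = ord_q Δ_min (component group) and γ supported at 2, 3 and Eisenstein primes
[BockleKhareManning2021]; deg φ ∣ η_f
(Ribet; [AgasheRibetStein2012]). On the definite side Pasten's hardest input (a Petersson LOWER
bound for integral
quaternionic forms) is free: ⟨φ,φ⟩ ≥ 1. Imported area: arithmetic of definite quaternion algebras /
Ramanujan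
(Pizer) graphs — φ is a simultaneous integer eigenvector of the Brandt matrices.
RANKED CRUXES. (rank 2) DegreeBoundModComponents: deg ≤ C c² N^(2+ε)·ord_v(Δ_min) for EVERY bad v —
exactly what
ξ(N/q;q) ≤ N^(2+ε) plus control of the 2,3-part of η delivers through the factorisation; it is
weaker than X and is
the statement the quaternionic census can kill. (rank 3) MinComponentBound: some bad fibre of a
semistable curve has
≤ C N^ε components (under Szpiro the minimum is ≤ 7; for Frey curves: min_p v_p(abc) ≤ C rad^ε) — a
sub-Szpiro
statement of independent interest, open. C1 ∧ C2 ⟹ X immediately. Support: PeterssonLowerBound (HL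
1994 +
Rankin–Selberg, named-fact level), LatticeInvariantBounds (classical, provable now), Assembly (glue,
provable now from
in-tree Frey/Szpiro files + the antecedent facts).
KILL CRITERIA. (i) Brandt-module census (Cremona semistable N ≤ 2·10⁴, one q per curve): log ξ/log N
drifting
above 2 kills C1's exponent; superpolynomial ξ kills the line. (ii) A semistable family with min_v
ord_v(Δ) ≥ N^δ
refutes C2 (and Szpiro). (iii) A proof that ord_2(η_f) is unbounded relative to log N on semistable
curves kills the
'γ small' step inside C1.
NOT DECOMPOSED YET (deliberately): C1 into XiBound (ξ ≤ C N^(2+ε) for all q ∣ N) ∧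
SmallPrimesCongruencePart
(2,3-part of η_f ≤ C N^ε) ∧ the PW/BKM identity as a Literature fact — waits for the definitions of
the congruence
number and of the Brandt module / JL vector (definition requests filed with this route); the
abc-triple form of C2.
NOVELTY (short; full in the Novelty field): nearest prior art Pasten2024Shimura (indefinite Shimura
curves only),
PollackWeston2011 (definite formula, used for μ-invariants),
Frey1997Ternary/Murty1999CongruencePrimes (degree ⟺ abc).
Delta: the definite factorisation as the attack on the degree conjecture, with the typed
intermediate C1 and the
component crux C2. BARRIERS (short): Baker-type bounds not used; ε kept everywhere
(SzpiroEpsilonCannotBeDropped);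
nothing from IUT; no derivation transfer.

Novelty: Nearest prior art (searched 2026-08-15: lit search --hybrid "modular degree congruence number
Szpiro"; zbMATH "modular degree abc conjecture" → Frey 1997 (doi:10.1007/978-1-4612-1974-3_20,
Frey1997Ternary), Murty 1999 (doi:10.1090/pspum/066.1/1703750, Murty1999CongruencePrimes), Goldfeld
2002 survey zbl:1046.11035; zbMATH "abc conjecture modular degree quaternion" → only Pasten, JNT 254
(2024) = arXiv:1705.09251 (Pasten2024Shimura, degree RATIOS on INDEFINITE Shimura curves, needs a
Petersson lower bound for quaternionic forms, his Thm 1.6); zbMATH "Pollack Weston" →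
PollackWeston2011 (doi:10.1112/s0010437x11005318: ξ_f(N⁺,N⁻)=⟨φ,φ⟩ and η_f(N)=ξ·∏c_q, aimed at
μ-invariants, never at Szpiro); BockleKhareManning2021 (doi:10.1112/s0010437x21007454, Wiles defect
= Tamagawa part); galaxy --star all "Brandt module Szpiro": 0 hits; the idea card
ABC/ABC/definite-quaternion-xi-szpiro (triage + novelty audit: new-combination) is the source of the
mechanism.
Delta: the degree conjecture (known abc-equivalent, Frey1997Ternary) is attacked through the
DEFINITE quaternionic factorisation η_f = ξ(N/q;q)·ord_q(Δ)·γ, which (a) discharges the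
level-lowering/Tamagawa part by proved theorems, (b) leaves the norm of an INTEGER Brandt
eigenvector where the Petersson lower bound is trivial, and (c) yields two typed, individually
weaker statements — DegreeBoundModComponents (deg ≤ N^{2+ε}·ord_v Δ for every bad v) and
MinComponentBound (some bad fibre has ≤ N^ε components) — whose conjunction is the  [refs: 10.1007/978-1-4612-1974-3_20, 10.1090/pspum/066.1/1703750, 10.1112/s0010437x11005318:, 10.1112/s0010437x21007454, 1705.09251, doi:10.1007/978-1-4612-1974-3_20, doi:10.1090/pspum/066.1/1703750, doi:10.1112/s0010437x11005318, doi:10.1112/s0010437x21007454, PollackWeston2011, BockleKhareManning2021]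

Barriers (technique_class: definite-quaternion congruence-number modular-degree): technique_class: definite-quaternion congruence-number modular-degree
- Literature.Barriers.ABC.BakerMethodBounds: not in the technique class — no linear forms in
logarithms anywhere; it is the benchmark the line must beat (log Δ ≪ N log N from Murty–Pasten is
already Baker-free), and C1/C2 say which integer must be polynomial for that.
- Literature.Barriers.ABC.SzpiroEpsilonCannotBeDropped: respected — every statement keeps its ε
(N^{2+ε}, N^ε, (f,f) ≫ N^{1−ε}); Masser's semistable families have deg φ ≈ N²·exp(O(√log N)),
consistent with X and C1.
- Literature.Barriers.ABC.EpsilonCannotBeDropped: the assembly outputs c ≪ rad^{1+ε'} only; no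
ε-free claim.
- Literature.Barriers.ABC.IUTDisputedClaim: nothing imported from IUT; independent mechanism.
- Literature.Barriers.ABC.IntegersHaveNoDerivation: not engaged — no function-field transfer of a
derivative (Papikian's function-field degree route is cited in the card only to locate the crux).
- Literature.Barriers.ABC.UniformABCImpliesNoSiegelZeros: not triggered — everything is over ℚ; the
only 'no Siegel zero' input is Hoffstein–Lockhart for GL(3) symmetric squares, a theorem.
- Negatives index (ledger negatives --problem ABC, 2026-08-15): 0 refuted statements; nothing here
restates one.

Novelty grade: new-combination — ROUTE REVIEW (refuter-rreview-…-f4089ca2-0, 2026-08-15; grade kept at the card audit's new-combination for the MECHANISM, which is untyped here). Typed layer is KNOWN as such: target X = modular degree conjecture for semistable curves (Frey 1987/97, Mai–Murty, Murty 1999 'Bounds for congruence prime (refuter refuter-rreview-route-HubbardSuperconduc-f4089ca2-0, 2026-08-15T11:21:32Z; prior: doi:10.1090/pspum/066.1/1703750, doi:10.1007/978-1-4612-1974-3_20, doi:10.1112/s0010437x11005318, arXiv:1705.09251, route-ABC-DefiniteXi, route-ABC-RibetTakahashiSplit)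

History (route lifecycle, newest last):
- 2026-08-15T16:13:56Z · CLOSED superseded — superseded:route-ABC-DefiniteXi (planner-rbadge-ABC-QuaternionicDegree-334a4366-g4-0)

sub-problem: ABC · status: closed(superseded) · opened planner-plan-ABC-0 2026-08-15T10:58:15Z · rev 1 · ledger route-ABC-QuaternionicDegree
GENERATED by the gate from the ledger (D-0016/17). Provers cite these decls: `theorem foo : Summit.ABC.ABC.Theses.QuaternionicDegree.<Decl> := …` in Summits/ABC/ABC/Theorems/<Name>.lean.
-/

namespace Summit.ABC.ABC.Theses.QuaternionicDegree

open scoped BigOperators Topology Manifold Classical MeasureTheory ProbabilityTheory Matrix InnerProductSpace ComplexConjugate ContinuousMap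
open Filter Set Function TopologicalSpace MeasureTheory

attribute [summit_statement] _root_.ABC

open Literature.Abc

/-- item stmt-ABC-1716 · target · rank 0 · closed · moot by None · by planner
why it might fail: abc-equivalent (Frey1997Ternary Prop 3.1/Cor 3.1: log deg φ = 2h(E)+O(log N), semistable; degree ⇔ height conj ⇒ abc): false iff polynomial Szpiro fails. ε load-bearing: Masser1990 + (f,f) ≫ N^{1-ε} force deg/c² > N²(log N)^k i.o. Typing OK: deg/c² datum-free (Zagier), level = conductor (IsNewform0)
sources: Frey1997Ternary, Murty1999CongruencePrimes, ZagierCMB1985, Masser1990, Pasten2024Shimura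
[target] Modular degree conjecture for semistable E/ℚ in datum form: deg ≤ C(ε)·c²·N^{2+ε} for every
parametrisation datum (deg/c² = 4π²(f,f)/covol Λ_W is datum-independent by Zagier). Classical
abc-equivalent on the modular side (Frey1997Ternary, Murty1999CongruencePrimes); implied by ABC via
generalized Szpiro + (f,f) ≪ N^{1+ε}. -/
@[route_item "route-ABC-QuaternionicDegree"]
def SemistableDegreeConjecture : Prop :=
  ∀ ε : ℝ, 0 < ε → ∃ C : ℝ, ∀ (W : WeierstrassCurve ℚ) [W.IsElliptic] [W.IsGloballyMinimal] (N : ℕ) [NeZero N] (D : Literature.NumberTheory.EllipticCurves.ModularForms.ModularParametrizationData W N), W.IsSemistable ℤ → (D.deg : ℝ) ≤ C * (D.c : ℝ) ^ 2 * (N : ℝ) ^ (2 + ε)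

/-- item stmt-ABC-1718 · crux · rank 2 · closed · moot by None · by planner
why it might fail: abc-strength even where min_v ord_v(Δ)=1 (there C1 = target ⇒ polynomial Szpiro; no method bounds deg ≪ N^A: Frey1997Ternary Prop 3.1). Mechanism: PW Thm 6.8 η_f=ξ(N/q;q)·ord_qΔ holds only under hyp. CR (p≥5, non-Eisenstein); 2,3-parts and size of ξ (integral Brandt eigenvector norm) uncontrolled.
sources: Frey1997Ternary, PollackWeston2011, RibetTakahashi1997, AgasheRibetStein2012, BockleKhareManning2021, Murty1999CongruencePrimes
[crux] For every bad place v of a semistable E: deg ≤ C(ε)·c²·N^{2+ε}·ord_v(Δ_min). MECHANISM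
(definite quaternion algebra B_{q,∞}, q = p_v): deg φ ∣ η_f (Ribet/ARS) and η_f = ξ_f(N/q;q)·c_q·γ
(Pollack–Weston Thm 6.8 from Ribet–Takahashi + Khare; hypotheses removed by Böckle–Khare–Manning),
c_q = ord_q Δ_min, ξ = Σ w_i φ(I_i)² for the primitive integral JL eigenvector φ on Cl(O_{N/q,q}), γ
supported at ℓ ∈ {2,3} ∪ Eisenstein; the bet is ξ ≤ C N^{2+ε} ('an integer Ramanujan-graph
eigenvector cannot be long') and γ ≤ N^ε. Planned split once η_f / Brandt-module definitions land:
XiBound ∧ SmallPrimesCongruencePart ∧ PW-identity fact. -/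
@[route_item "route-ABC-QuaternionicDegree"]
def DegreeBoundModComponents : Prop :=
  ∀ ε : ℝ, 0 < ε → ∃ C : ℝ, ∀ (W : WeierstrassCurve ℚ) [W.IsElliptic] [W.IsGloballyMinimal] (N : ℕ) [NeZero N] (D : Literature.NumberTheory.EllipticCurves.ModularForms.ModularParametrizationData W N), W.IsSemistable ℤ → ∀ v : IsDedekindDomain.HeightOneSpectrum ℤ, 0 < W.ordMinimalDiscriminant v → (D.deg : ℝ) ≤ C * (D.c : ℝ) ^ 2 * (N : ℝ) ^ (2 + ε) * (W.ordMinimalDiscriminant v : ℝ)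

/-- item stmt-ABC-1719 · crux · rank 3 · closed · moot by None · by planner
why it might fail: Open exactly for few bad primes: Pasten2024Shimura Thm 1.12 (∏_{p|N}v_p(Δ) ≪ N^{11/2+ε}) gives min ≤ K·N^{5.6/ω(N)}, settling ω(N) ≥ 6/ε; ω=1: Mestre–Oesterlé Δ∣N^5. For 2 ≤ ω(N) < 6/ε only min ≪ N (Murty–Pasten) or rad^{1/3+ε} on Frey curves (Stewart–Yu); B–Y local Szpiro Conj 1.2 is open.
sources: Pasten2024Shimura, BennettYazdani2012, MestreOesterle1989, MurtyPasten2013, StewartYu2001, Masser1990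
[crux] Some bad fibre of a semistable E/ℚ has few components: min over bad v of ord_v(Δ_min) ≤ C(ε)
N^ε (Szpiro gives ≤ 7 for large N since min ≤ weighted mean ≤ 6+ε). For Serre-normalised Frey curves
ord_p Δ_min = 2 v_p(abc) (p odd), so this reads min_{p∣abc} v_p(abc) ≤ C rad(abc)^ε — weaker than
subexponential abc (log c ≪ rad^ε), open; Stewart–Yu only give rad^{1/3+ε}. With
DegreeBoundModComponents it gives the target at once. -/
@[route_item "route-ABC-QuaternionicDegree"]
def MinComponentBound : Prop :=
  ∀ ε : ℝ, 0 < ε → ∃ C : ℝ, ∀ (W : WeierstrassCurve ℚ) [W.IsElliptic], W.IsSemistable ℤ → (∃ v : IsDedekindDomain.HeightOneSpectrum ℤ, 0 < W.ordMinimalDiscriminant v) → ∃ v : IsDedekindDomain.HeightOneSpectrum ℤ, 0 < W.ordMinimalDiscriminant v ∧ (W.ordMinimalDiscriminant v : ℝ) ≤ C * ((W.conductorNorm ℤ : ℕ) : ℝ) ^ ε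

/-- item stmt-ABC-1720 · support · rank 9 · closed · moot by None · by planner
sources: HoffsteinLockhart1994, Murty1999CongruencePrimes
[support] (f,f)_{Γ₀(N)} ≥ C(ε) N^{1−ε} for the newform of any parametrisation datum (arithmetic
normalisation a₁ = 1; peterssonProduct of HeckeOperators.lean, no volume normalisation). Printed
route: Rankin–Selberg (f,f) ≍ [SL₂ℤ:Γ₀(N)]·L(sym² f,1)·const and L(sym² f,1) ≫ 1/log N
(Hoffstein–Lockhart 1994 with the Goldfeld–Hoffstein–Lieman appendix; Murty 1999 uses exactly
N^{1−ε} ≪ (f,f)). Expected to become a Literature named fact; grounder: cite item. -/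
@[route_item "route-ABC-QuaternionicDegree"]
def PeterssonLowerBound : Prop :=
  ∀ ε : ℝ, 0 < ε → ∃ C : ℝ, 0 < C ∧ ∀ (W : WeierstrassCurve ℚ) [W.IsElliptic] (N : ℕ) [NeZero N] (D : Literature.NumberTheory.EllipticCurves.ModularForms.ModularParametrizationData W N), C * (N : ℝ) ^ (1 - ε) ≤ (Literature.NumberTheory.EllipticCurves.ModularForms.peterssonProduct (CongruenceSubgroup.Gamma0 N) 2 D.f D.f).re

/-- item stmt-ABC-1721 · support · rank 9 · closed · moot by None · by planner
sources: SilvermanAEC2009, ZagierCMB1985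
[support] Archimedean lattice analysis, provable now: for every period pair L, max(|g₂|³,|Δ(L)|) ≤
C·covol(L)^{-6}·(1+log(1+|j/1728|))^6. Scale-invariant; on a reduced basis τ (y ≥ √3/2) with covol =
|ω₁|² y: |Δ(τ)| y^6 ≪ 1 and |g₂(τ)|³ y^6 ≪ y^6 ≪ (1 + log⁺|j(τ)|)^6 since |j| ≍ e^{2πy}. Mathlib:
PeriodPair, ZLattice.covolume, ModularGroup.fd, Eisenstein series q-expansions. -/
@[route_item "route-ABC-QuaternionicDegree"]
def LatticeInvariantBounds : Prop :=
  ∃ C : ℝ, ∀ L : PeriodPair, max (‖L.g₂‖ ^ 3) ‖L.g₂ ^ 3 - 27 * L.g₃ ^ 2‖ ≤ C * (ZLattice.covolume L.lattice)⁻¹ ^ 6 * (1 + Real.log (1 + ‖L.g₂ ^ 3 / (L.g₂ ^ 3 - 27 * L.g₃ ^ 2)‖)) ^ 6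

/-- item stmt-ABC-1717 · assembly · rank 1 · closed · moot by None · by planner
sources: ZagierCMB1985, BombieriGubler2006, HoffsteinLockhart1994
[assembly] modularity (nonempty_modularParametrizationData) → Zagier's formula for every datum →
PeterssonLowerBound → LatticeInvariantBounds → Serre-normalised Frey curves semistable
(isSemistable_freyCurve_of_mod) → SemistableDegreeConjecture → ABC. Proof plan: for an abc triple
take the global minimal model W of the normalised Frey curve (in-tree exists_arrangement /
exists_minimal_frey_model, hasGlobalMinimalModel_rat_holds), datum D at N = conductor ∣ 2^8·rad;
target ⇒ covol(Λ_W) ≥ 4π²(f,f)/(C N^{2+ε}) ≫ N^{-1-2ε}; lattice bounds with g₂ = c₄/12 ⇒ |c₄|³ ≪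
N^{6+12ε}(log N)^6; c₄(W) = u^{-4}·16(a²+ab+b²), u ∣ 2 ⇒ c^6 ≪ rad^{6+13ε} ⇒ ABC (strict form via C
↦ C+1). -/
@[route_item "route-ABC-QuaternionicDegree"]
def Assembly : Prop :=
  Literature.NumberTheory.EllipticCurves.ModularForms.nonempty_modularParametrizationData → (∀ (W : WeierstrassCurve ℚ) (N : ℕ) [NeZero N] (D : Literature.NumberTheory.EllipticCurves.ModularForms.ModularParametrizationData W N), D.zagier_degree_formula) → PeterssonLowerBound → LatticeInvariantBounds → (∀ a b : ℤ, Literature.NumberTheory.EllipticCurves.isSemistable_freyCurve_of_mod a b) → SemistableDegreeConjecture → _root_.ABC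

end Summit.ABC.ABC.Theses.QuaternionicDegree
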